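import Literature.NumberTheory.EllipticCurves.CastellaGrossiLeeSkinner2022.AnticyclotomicControl
import Literature.NumberTheory.EllipticCurves.FormalGroupPadicLogPointProofs
import Literature.NumberTheory.EllipticCurves.ComplexMultiplicationCoatesWilesSeparationProofs
import Literature.NumberTheory.EllipticCurves.MordellWeilTheoremProofs
import Literature.NumberTheory.EllipticCurves.TwoDescentLocalPadic
import HarnessLib

/-!
# `ord_p log_{ω_E}` of a rank-one point does not depend on the embedding `K ↪ ℚ_p` up to an
# involution of `K` — the reading note `CGLS-CTL-log-prime` as a kernel theorem (CGLS's "log at the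
# prime `v` induced by `ι_p`, module strict at `v̄`" versus Jetchev–Skinner–Wan's / Castella's
# "log at the strict prime")

HONEST FRAMING (cell `b2b-bsdres`, run/shared/lean/b2b/bsd-rank1-residual/; verbatim): the goal is to
DELETE the COMBINATION-SHAPED residual classes for ALL analytic-rank `≤ 1` curves over `ℚ` — "full BSD
formula for every rank `≤ 1` curve in class `C`" assembled STRICTLY from published theorems — so
that the rank-`≤ 1` remainder becomes exactly the CONSTRUCTION-SHAPED classes, which are TYPED
(missing-input `Prop`s), NOT attempted; this is not "finishing BSD". NEW WORK of the cell (an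
elementary lemma and bookkeeping over decls already in the tree), hence under `Summits/`; NO
definition, NO named fact, nothing about any particular curve asserted; no label moves. Unit
`b2b-bsdres-lit-cgls` (off-peak literature typer: Castella–Grossi–Lee–Skinner 2022 /
Greenberg–Vatsal 2000), session 6 — sized ask S13 of `HOME/b2b-bsdres-lit-cgls/CGLS-GV-TYPING.md`
§12.11 ("prove the elementary reductions").

## Why

Castella–Grossi–Lee–Skinner 2022 Thm. 5.1.1 (registry A170, `thm511_anticyclotomicControl`) is stated
for `𝔛_E` STRICT at `v̄` and RELAXED at `v`, with the local term `log_{ω_E} : E(K_v) → ℤ_p` at the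
prime `v` INDUCED BY the fixed embedding `ι_p` — and is proved by reference to Jetchev–Skinner–Wan
2017 Thm. 3.3.1 + (3.5.d), whose anticyclotomic Selmer structure (JSW §2.3.2–2.3.3, arXiv:1512.06894
p. 7: "`H¹_ac(K_w, M) = H¹(K_v̄, M)` if `w = v̄`, … , `0` else") is STRICT at `v`, RELAXED at `v̄`,
with the local term `δ_v` (the localisation AT THE STRICT PRIME `v`, §3.2). Castella 2018 Thm. 2.3
and the cell's Summits predicates (`X11b.ControlOnTreeGoodAt p κ 𝔭 γ (embAt K p 𝔭) P`, lit-glue's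
`…OnTreeGoodAt`, registry A174 `JetchevSkinnerWan2017.thm331_anticyclotomicControl`) follow JSW's
letter: log AT the strict prime. The two letters differ by the exchange `v ↔ v̄` in the logarithm
only; the reading note `CGLS-CTL-log-prime` (CGLS-GV-TYPING §12.2) asserted in prose that "under
`rank_ℤ E(K) = 1` the two valuations agree (complex conjugation acts on `E(K)/tors ≅ ℤ` by `±1` and
swaps the two embeddings)". This file PROVES that sentence:

* `exists_isOfFinAddOrder_sub_or_add_of_finrank_eq_one` — in a finitely generated abelian group of
  rank one, an additive involution `σ` moves a non-torsion `P` to `±P + (torsion)`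
  (`{P, σP}` is linearly dependent; apply `σ` to the relation).
* `padicLogPoint_neg` — `log_W(−Q) = −log_W(Q)` on `E₁(ℚ_p)` (from the tree's PROVED additivity
  `padicLogPoint_add_holds`); `ord_p(−x) = ord_p x` is the tree's `TwoDescentLocal.valuation_neg'`.
* **`padicLogOrd_comp_eq_of_rank_one`** — for `W/ℚ` globally minimal elliptic, `p` odd, `K` a number
  field with `rank_ℤ E(K) = 1`, an involutive `σ : K →+* K` (e.g. complex conjugation of an imaginary
  quadratic field) and `ι : K →+* ℚ_p`: `padicLogOrd W p (ι ∘ σ) P = padicLogOrd W p ι P` for every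
  non-torsion `P ∈ E(K)` (torsion dies in `E₁(ℚ_p)`, torsion-free for `p ≠ 2`:
  `eq_zero_of_isOfFinAddOrder_of_isInReductionKernel`).
* **`hasCharValuationAt_of_thm511_comp`** — hence CGLS Thm. 5.1.1 (A170) ALSO delivers its formula
  with the logarithm read along `ι ∘ σ` (for an imaginary quadratic `K`: at the OTHER prime `v̄`, the
  strict one) — the Jetchev–Skinner–Wan / Castella letter — at every datum of the theorem
  (`rank_ℤ E(K) = 1` is among its hypotheses). So A170 feeds the cell's predicates in EITHER
  convention; the reading note is discharged in the kernel.

References: [CastellaGrossiLeeSkinner2022] Thm. 5.1.1 and its proof (arXiv:2008.02571v2 TeX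
L2403–L2429); [JetchevSkinnerWan2017] §2.3.2–2.3.3 (p. 7), §3.2 (3.5.d), Thm. 3.3.1 (arXiv:1512.06894
pp. 10–11); [Castella2018] §2.2, Thm. 2.3; [SilvermanAEC2009] IV.6.1, VII.2.2, VII.3.1, VIII.6.7;
HOME/b2b-bsdres-lit-cgls/CGLS-GV-TYPING.md §12.2 (`CGLS-CTL-log-prime`), §13.
-/

noncomputable section

open scoped Classical

open WeierstrassCurve NumberField IsDedekindDomain Literature.NumberTheory.EllipticCurves
  Literature.NumberTheory.EllipticCurves.Rank1Residual
  Literature.NumberTheory.EllipticCurves.CastellaGrossiLeeSkinner2022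
  Literature.NumberTheory.EllipticCurves.Castella2018

namespace Summit.BirchSwinnertonDyer.Rank1Residual

/-! ### §1 An involution of a rank-one abelian group moves a non-torsion point to `±P + torsion` -/

/-- **Rank one: `σP = ±P + (torsion)`.** In a finitely generated abelian group `M` with
`rank_ℤ M = 1`, for an additive `σ` with `σ ∘ σ = id` and a non-torsion `P`, either `σP − P` or
`σP + P` has finite order. Proof: `{P, σP}` is `ℤ`-linearly dependent (`card = 2 > 1 = rank`), say
`aP + bσP = 0`; applying `σ` gives `bP + aσP = 0`, whence `(a² − b²)P = 0`, so `b = ±a ≠ 0` and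
`a(σP ± P) = 0`. (Complex conjugation on `E(K)/E(K)_tors ≅ ℤ` acts by `±1`.)
[cite: SilvermanAEC2009, VIII.6.7 (Mordell–Weil: `E(K) ≅ ℤ^r ⊕ E(K)_tors`)] -/
theorem exists_isOfFinAddOrder_sub_or_add_of_finrank_eq_one {M : Type*} [AddCommGroup M]
    [Module.Finite ℤ M] (h1 : Module.finrank ℤ M = 1) (σ : M →+ M) (hσ : ∀ x, σ (σ x) = x)
    (P : M) (hP : ¬ IsOfFinAddOrder P) :
    IsOfFinAddOrder (σ P - P) ∨ IsOfFinAddOrder (σ P + P) := by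
  -- `{P, σ P}` is linearly dependent over `ℤ`
  have hdep : ¬ LinearIndependent ℤ ![P, σ P] := by
    intro hli
    have h2 := hli.fintype_card_le_finrank
    rw [Fintype.card_fin, h1] at h2
    omega
  rw [LinearIndependent.pair_iff] at hdep
  push Not at hdep
  obtain ⟨a, b, hab, hne⟩ := hdep
  -- apply `σ`
  have hba : b • P + a • σ P = 0 := by
    have := congrArg σ hab
    rw [map_add, map_zsmul, map_zsmul, hσ, map_zero] at this
    rw [add_comm]; exact this
  -- `(a² − b²) • P = 0`
  have hsq : (a * a - b * b) • P = 0 := by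
    calc (a * a - b * b) • P = a • (a • P + b • σ P) - b • (b • P + a • σ P) := by module
      _ = 0 := by rw [hab, hba, smul_zero, smul_zero, sub_self]
  have hab2 : a * a = b * b := by
    by_contra hc
    exact hP ((isOfFinAddOrder_iff_zsmul_eq_zero).mpr ⟨a * a - b * b, sub_ne_zero.mpr hc, hsq⟩)
  have ha0 : a ≠ 0 := by
    rintro rfl
    have hb : b ≠ 0 := hne rfl
    rw [zero_mul, eq_comm, mul_self_eq_zero] at hab2
    exact hb hab2
  rcases mul_self_eq_mul_self_iff.mp hab2 with rfl | rfl
  · -- `b = a`: `a • (σ P + P) = 0`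
    right
    refine (isOfFinAddOrder_iff_zsmul_eq_zero).mpr ⟨a, ha0, ?_⟩
    rw [smul_add, add_comm]; exact hab
  · -- `a = -b`: `b • (σ P - P) = 0`
    left
    refine (isOfFinAddOrder_iff_zsmul_eq_zero).mpr ⟨b, neg_ne_zero.mp ha0, ?_⟩
    rw [smul_sub]
    rwa [neg_smul, ← sub_eq_neg_add] at hab

/-! ### §2 `log_W(−Q) = −log_W(Q)` on `E₁(ℚ_p)` (`ord_p(−x) = ord_p x` is the tree's `TwoDescentLocal.valuation_neg'`) -/

section Padic

variable {p : ℕ} [Fact p.Prime]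

/-- `log_W ∘ z` is odd on `E₁(ℚ_p)` (minimal equation): from the tree's PROVED additivity
`padicLogPoint_add_holds` at `(Q, −Q)` and `log_W(z(O)) = 0`. [cite: SilvermanAEC2009, IV.6.4 and VII.2.2] -/
theorem padicLogPoint_neg (W₀ : WeierstrassCurve ℚ_[p]) [W₀.IsMinimal ℤ_[p]] {Q : W₀.toAffine.Point}
    (hQ : W₀.IsInReductionKernel Q) : W₀.padicLogPoint (-Q) = -W₀.padicLogPoint Q := by
  have h := (padicLogPoint_add_holds p W₀ Q (-Q) hQ (W₀.isInReductionKernel_neg hQ)).2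
  rw [add_neg_cancel, padicLogPoint_zero] at h
  exact (neg_eq_of_add_eq_zero_right h.symm).symm

end Padic

/-! ### §3 `ord_p log_{ω_E} P` along `ι ∘ σ` equals `ord_p log_{ω_E} P` along `ι` in rank one -/

section Symmetry

variable (W : WeierstrassCurve ℚ) [W.IsElliptic] [W.IsGloballyMinimal] (p : ℕ) [Fact p.Prime]
  {K : Type} [Field K] [NumberField K]

omit [W.IsElliptic] [W.IsGloballyMinimal] in
/-- Functoriality of the reading `P ↦ P_ι`: `P_{ι∘σ} = (σ_* P)_ι`. [folklore] -/
theorem padicPointOf_comp (σ : K →+* K) (ι : K →+* ℚ_[p]) (P : (W.baseChange K).toAffine.Point) :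
    padicPointOf W p (ι.comp σ) P =
      padicPointOf W p ι (WeierstrassCurve.Affine.Point.map σ.toRatAlgHom P) := by
  unfold padicPointOf
  rw [WeierstrassCurve.Affine.Point.map_map]
  congr 1

/-- **`ord_p log_{ω_E}(P)` read along `ι ∘ σ` equals `ord_p log_{ω_E}(P)` read along `ι`, for a
non-torsion `P` of a RANK-ONE `E(K)`, `σ` an involution of `K`, `p` odd.** By §1, `σ_* P = εP + T`
with `ε = ±1` and `T` torsion (Mordell–Weil: `E(K)` finitely generated, `module_finite_point_holds`);
in `E(ℚ_p)`, `m₀ • T_ι ∈ E₁(ℚ_p)` (`m₀ = [E(ℚ_p):E₁(ℚ_p)]`) is torsion, hence `O`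
(`eq_zero_of_isOfFinAddOrder_of_isInReductionKernel`, `p ≠ 2`); so `m₀ • (σ_*P)_ι = ±(m₀ • P_ι)` and
`log_W` is odd (§2). For an imaginary quadratic `K` with `p` split and `σ` = complex conjugation,
`ι ∘ σ` is the embedding inducing the OTHER prime above `p`: "`ord_p log_v P = ord_p log_v̄ P` under
`rank_ℤ E(K) = 1`". [cite: CastellaGrossiLeeSkinner2022, Thm. 5.1.1 ("`log_{ω_E} : E(K_v)_{/tors} → ℤ_p`", `v` induced by `ι_p`)]
[cite: JetchevSkinnerWan2017, §2.3.2 (p. 7) and §3.2 (`δ_v` at the strict prime)] [cite: SilvermanAEC2009, IV.6.1, VII.3.1] -/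
theorem padicLogOrd_comp_eq_of_rank_one (hp : p ≠ 2) (σ : K →+* K) (hσ : ∀ x, σ (σ x) = x)
    (ι : K →+* ℚ_[p]) (hrk : (W.baseChange K).mordellWeilRank = 1)
    (P : (W.baseChange K).toAffine.Point) (hP : ¬ IsOfFinAddOrder P) :
    padicLogOrd W p (ι.comp σ) P = padicLogOrd W p ι P := by
  haveI : (W.baseChange K).IsElliptic := by rw [baseChange]; infer_instance
  haveI : Module.Finite ℤ (W.baseChange K).toAffine.Point := (W.baseChange K).module_finite_point_holds
  haveI : (W.baseChange ℚ_[p]).IsMinimal ℤ_[p] := isMinimal_map_padic_of_isGloballyMinimal W p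
  -- the involution `σ_*` of `E(K)`
  set f : (W.baseChange K).toAffine.Point →+ (W.baseChange K).toAffine.Point :=
    WeierstrassCurve.Affine.Point.map σ.toRatAlgHom with hf
  have hff : ∀ Q, f (f Q) = Q := by
    rintro (_ | ⟨x, y, hxy⟩)
    · rfl
    · simp only [hf, WeierstrassCurve.Affine.Point.map_some]
      congr 1 <;> exact hσ _
  -- the two readings in `E(ℚ_p)`
  set ιP := padicPointOf W p ι P with hιP
  have hcomp : padicPointOf W p (ι.comp σ) P = padicPointOf W p ι (f P) := padicPointOf_comp W p σ ι P
  set m : ℕ := formalIndex W p with hm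
  -- the image of a torsion point dies after multiplication by `m` (it lands in the torsion-free `E₁`)
  have hkill : ∀ T : (W.baseChange K).toAffine.Point, IsOfFinAddOrder T →
      m • padicPointOf W p ι T = 0 := fun T hT ↦ by
    have hmem : m • padicPointOf W p ι T ∈ (W.baseChange ℚ_[p]).formalFiltration 1 :=
      AddSubgroup.nsmul_index_mem _ _
    exact (W.baseChange ℚ_[p]).eq_zero_of_isOfFinAddOrder_of_isInReductionKernel hp hmem.1
      (((WeierstrassCurve.Affine.Point.map ι.toRatAlgHom).isOfFinAddOrder hT).nsmul)
  unfold padicLogOrd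
  rw [hcomp]
  rcases exists_isOfFinAddOrder_sub_or_add_of_finrank_eq_one hrk f hff P hP with hT | hT
  · -- `σ_* P = P + T`
    have hQ : f P = (f P - P) + P := by abel
    have : m • padicPointOf W p ι (f P) = m • padicPointOf W p ι P := by
      rw [hQ, padicPointOf, map_add, nsmul_add, ← padicPointOf, ← padicPointOf, hkill _ hT, zero_add]
    rw [this]
  · -- `σ_* P = −P + T`
    have hQ : f P = (f P + P) + (-P) := by abel
    have hmemP : m • padicPointOf W p ι P ∈ (W.baseChange ℚ_[p]).formalFiltration 1 :=
      AddSubgroup.nsmul_index_mem _ _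
    have : m • padicPointOf W p ι (f P) = -(m • padicPointOf W p ι P) := by
      rw [hQ, padicPointOf, map_add, nsmul_add, ← padicPointOf, hkill _ hT, zero_add, map_neg,
        neg_nsmul, ← padicPointOf]
    rw [this, padicLogPoint_neg _ hmemP.1, TwoDescentLocal.valuation_neg']

end Symmetry

/-! ### §4 CGLS Thm. 5.1.1 with the logarithm at the OTHER prime (the JSW / Castella letter) -/

section Thm511

variable {W : WeierstrassCurve ℚ} [W.IsElliptic] [W.IsGloballyMinimal] {p : ℕ} [Fact p.Prime]

/-- **A170 in EITHER convention.** Granted `thm511_anticyclotomicControl` (CGLS Thm. 5.1.1: module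
strict at `v̄`, logarithm along `ι` inducing `v`), at every datum of the theorem the packaged shape
`AcSelmer.XAc.HasCharValuationAt (E_K) p κ v̄ ∅ γ n` ALSO holds with
`n = ord_p #Ш(E/K)[p^∞] + 2·((ord_p(1−a_p+p) − 1 + ord_p log_{ι∘σ} P) − ord_p[E(K):ℤP]) + ord_p ∏_w c_w`
for any involution `σ` of `K` — for `σ` = complex conjugation, `ι ∘ σ` induces `v̄`, i.e. the
logarithm is read AT THE STRICT PRIME, which is the letter of Jetchev–Skinner–Wan 2017 Thm. 3.3.1 /
(3.5.d) (strict at `v`, `δ_v` at `v`) and of Castella 2018 Thm. 2.3, and the shape of the cell's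
`X11b.ControlOnTreeGoodAt p κ 𝔭 γ (embAt K p 𝔭) P` binders. (`rank_ℤ E(K) = 1`, `P` non-torsion and
`p > 2` are hypotheses of the theorem, so §3 applies.) The reading note `CGLS-CTL-log-prime` is thus
a kernel fact: the two printed letters are equivalent on the theorem's locus.
[cite: CastellaGrossiLeeSkinner2022, Thm. 5.1.1 and its proof by reference to [JSW] (arXiv v2 TeX L2403–L2429)]
[cite: JetchevSkinnerWan2017, Thm. 3.3.1, §2.3.3, §3.2 (arXiv:1512.06894 pp. 7, 10–11)]
[cite: Castella2018, Thm. 2.3 (arXiv:1704.06608 p. 5)] -/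
theorem hasCharValuationAt_of_thm511_comp (h : thm511_anticyclotomicControl) (hp : 2 < p)
    (hord : GoodOrd W p) (K : Type) [Field K] [NumberField K] (hK : IsImaginaryQuadratic K)
    (hHp : SatisfiesHeegnerHypothesis p K) (hHN : SatisfiesHeegnerHypothesis (W.conductorNorm ℤ) K)
    (ι : K →+* ℚ_[p]) (v vbar : HeightOneSpectrum (𝓞 K))
    (hv : ∀ x : 𝓞 K, x ∈ v.asIdeal ↔ ‖ι (x : K)‖ < 1)
    (hvbar : ((p : ℕ) : 𝓞 K) ∈ vbar.asIdeal) (hne : vbar ≠ v)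
    (κ : ZpExtension K p) (hκ : κ.IsAnticyclotomic)
    (γ : Field.absoluteGaloisGroup K) [Fact (κ.IsTopGenerator γ)]
    (hEp : ∀ Q : (W.baseChange ℚ_[p]).toAffine.Point, p • Q = 0 → Q = 0)
    (hrk : (W.baseChange K).mordellWeilRank = 1)
    (hfin : Finite (AddCommGroup.primaryComponent (W.baseChange K).sha p))
    (P : (W.baseChange K).toAffine.Point) (hP : ¬ IsOfFinAddOrder P)
    (σ : K →+* K) (hσ : ∀ x, σ (σ x) = x) :
    ∃ n : ℕ, AcSelmer.XAc.HasCharValuationAt (W.baseChange K) p κ vbar ∅ γ n ∧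
      (n : ℤ) = (padicValNat p (Nat.card (AddCommGroup.primaryComponent (W.baseChange K).sha p)) : ℤ) +
        2 * (((padicValInt p (1 - W.frobeniusTrace p + p) : ℤ) - 1 + padicLogOrd W p (ι.comp σ) P) -
          (padicValNat p (AddSubgroup.zmultiples P).index : ℤ)) +
        (padicValNat p (W.baseChange K).tamagawaProduct : ℤ) := by
  rw [padicLogOrd_comp_eq_of_rank_one W p (by omega) σ hσ ι hrk P hP]
  exact hasCharValuationAt_of_thm511 h hp hord K hK hHp hHN ι v vbar hv hvbar hne κ hκ γ hEp hrk hfin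
    P hP

end Thm511

end Summit.BirchSwinnertonDyer.Rank1Residual

end
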